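import Summits.QuantumFields.BalabanUV.T4Continuum.Support.B13ActivityRouteEnd

/-!
# NE5 ∕ U3, route P2 — END-B OVER THE WIRING OF RECORD: route P2's END on Bałaban's carriers stated over the supplier's own names
# `B13DomainGeometryTR.domainGeometry R` ∕ `B13DomainGeometryTR.clusterRep R ρA ρB` (the §4 addendum of `B13ActivityRouteEnd` v1.1,
# p209105 — stuck in the append-only lane since 2026-08-20T06:34Z — re-filed as its own module)

Cell `pub-balaban`, unit `b2b-balaban-t4-ne5-p2` (T⁴ fan-out NE5 ∕ node U3, PROVER seat P2 «polymer-activity Lipschitz ∕ Kotecký–Preiss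
route», lineage gen 18; content = gen 17's v1.1 §4; NE5 swarm referee pass 2 ruling (2), holder's DEDUP NOTE, typer WIRING RECORD of
2026-08-20: consumers import the supplier's TR names, `B13ActivityRouteEnd.domainGeometry_eq` ∕ `clusterRep_eq` keep the twin
interchangeable).  Summits-side new work under the LEAN PLACEMENT RULE (cell bookkeeping over landed leaves; NOT a Literature module;
[Balaban1988RG2Cluster] Lemma 3 (2.38) p. 20 is cited as the LOCATOR of a hypothesis SHAPE only).  HONEST FRAMING: rung (B)+1 of the
FINITE-VOLUME T⁴ continuum programme — NOT infinite volume, NOT a mass gap, NOT the Clay problem, NOT a proof of NE5 (spine 0∕9).  HONEST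
DEPENDENCY (cell line, verbatim): continuum YM on T⁴ ⇐ BetaPertH ∧ nine spine estimates (0/9 proved); BetaPertH ⇐ (D1) ∧ (D4) ∧ CAP+tail;
G-an2-4 gates asym, D1 and NE2/3/4.

WHAT.  `ne5_above_max_b13`: `ClusterRepDecay.ne5_above_max_of_domainGeometry_linear` at `G := B13DomainGeometryTR.domainGeometry R` with
the five polymer-geometry hypotheses `hloc`∕`hreach`∕`h126`∕`hvol`∕`h227` and the constants' signs DISCHARGED by
`B13DomainGeometryTR.loc_b13`∕`reach_b13`∕`ineq126_level`∕`volBound_level`∕`ineq227_level` (ν = 9, κ₀ = 64·log 162, K₀ = K₀(64,8), c₁ = 64,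
c = 5).  DISPLAYED, asserted nowhere: the term family + `WellFormed` + `hsum` against the (2.38)-shaped majorant (NODE O), MI-R,
`Represents`∕`Realizes`∕`InBase`, the decay bounds, W1 `OperatorRate` (rows NE2∕NE3), `BaseRate`∕`VecRate`∕`AgeBudget`, numerics.  Conclusion
literally `∃ C₅, NE5 EA EB W κ θ′ C₅`.  NOT a proof of NE5.  0 sorry; axioms ⊆ {propext, Classical.choice, Quot.sound}.  (If p209105 later
lands, its `B13ActivityRouteEnd.ne5_above_max_b13` is the same statement; this module is then a harmless twin.)
-/

open scoped BigOperators

namespace Summit.QuantumFields.BalabanUV.T4Continuum.B13ActivityRouteEndTR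

open Literature.MathematicalPhysics.QuantumFieldTheory.Balaban1983to89
open Literature.MathematicalPhysics.QuantumFieldTheory.Balaban1983to89.T4OutputRate (Carriers Functional DecayBound NE5)
open Literature.MathematicalPhysics.QuantumFieldTheory.Balaban1983to89.T4ActivityRecursion (KPInflated)
open Literature.MathematicalPhysics.QuantumFieldTheory.Balaban1983to89.T4InputCauchyRateData (StepModel)
open Summit.QuantumFields.BalabanUV.T4Continuum.B13Carriers (TwoRuns)
open Summit.QuantumFields.BalabanUV.T4Continuum.ClusterRepOfDomains (DomainGeometry)
open Summit.QuantumFields.BalabanUV.T4Continuum.ClusterRepDecay (ne5_above_max_of_domainGeometry_linear)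
open Summit.QuantumFields.BalabanUV.T4Continuum.InsertionLinearClass (LinearInsertion)
open Summit.QuantumFields.BalabanUV.T4Continuum.InsertionLinearRate.LinearPair (ReadsB BaseRate VecRate)
open Summit.QuantumFields.BalabanUV.T4Continuum.ActivityTermModel (TermFamily)
open Summit.QuantumFields.BalabanUV.T4Continuum.ActivityStepJunction (ReadsStep)

variable {G : Type} [GaugeGroup G]
variable {Op Hist : Type*} [NormedAddCommGroup Op] [NormedSpace ℂ Op] [NormedAddCommGroup Hist] [NormedSpace ℂ Hist]
variable {ι κι S Ω Ω₀ 𝒴 𝒞 : Type*} [Fintype ι] [Fintype κι] [MeasurableSpace Ω] [MeasurableSpace Ω₀] {J : Type*}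
  [DecidableEq ι] [DecidableEq κι] [DecidableEq 𝒞]

/-- [folklore] **ROUTE P2's END OVER THE WIRING OF RECORD** (`B13DomainGeometryTR.domainGeometry R` ∕ `B13DomainGeometryTR.clusterRep R ρA ρB`):
the same END as `B13ActivityRouteEnd.ne5_above_max_rec`, stated over the supplier's own names so that consumers of the wiring of record need no
rewrite — `ClusterRepDecay.ne5_above_max_of_domainGeometry_linear` at `G := B13DomainGeometryTR.domainGeometry R` with `hloc`∕`hreach`∕`h126`∕
`hvol`∕`h227` and the constants' signs DISCHARGED by `B13DomainGeometryTR.loc_b13`∕`reach_b13`∕`ineq126_level`∕`volBound_level`∕`ineq227_level`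
(ν = 9, κ₀ = 64·log 162, K₀ = K₀(64,8), c₁ = 64, c = 5).  DISPLAYED, asserted nowhere: the term family + `WellFormed` + `hsum` against the
(2.38)-shaped majorant (NODE O), MI-R, `Represents`∕`Realizes`∕`InBase`, the decay bounds, W1 `OperatorRate` (rows NE2∕NE3), `BaseRate`∕`VecRate`∕
`AgeBudget`, numerics.  NOT a proof of NE5.  (Interchangeable with the `_rec` END through `B13ActivityRouteEnd.clusterRep_eq`.)
[cite: Balaban1988RG2Cluster, Lemma 3 (2.38) p.20] -/
theorem ne5_above_max_b13 (R : TwoRuns G) (ρA ρB : (ℕ → ℝ) → R.carriers.BgB → R.carriers.Dom → ℂ)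
    (𝔉 : TermFamily (B13DomainGeometryTR.clusterRep R ρA ρB) Op Hist ι κι S Ω Ω₀ 𝒴 𝒞 J)
    {N : StepModel R.carriers Op Hist} (hN : ReadsStep 𝔉.model N)
    {EA : Functional R.carriers R.carriers.BgA} {EB : Functional R.carriers R.carriers.BgB} {W : Set (ℕ → ℝ)}
    {LA LB : LinearInsertion R.carriers Hist} (hLA : LA.Reads N W) (hLB : ReadsB LB N W) (hdom : ∀ k, LA.dom k = LB.dom k)
    {m : (ℕ → ℝ) → R.carriers.BgB → R.carriers.Dom → ℝ}
    {A_m R_m τ σ s A₀ E₀ E₁ κ θ δ δb δv cg ω Λop Λhist ρ₀ ρ₀' : ℝ}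
    -- R-KP in letters: the (2.38)-shaped majorant and the two explicit inequalities
    (hA_m : 0 ≤ A_m) (hτ : 0 ≤ τ) (hσ : 0 ≤ σ) (hs0 : 0 ≤ s)
    (hm0 : ∀ (g : ℕ → ℝ) (U : R.carriers.BgB) (Z : R.carriers.Dom), 0 ≤ m g U Z)
    (hm : ∀ g ∈ W, ∀ (U : R.carriers.BgB) (k : ℕ), ∀ Z ∈ R.domAt k, m g U Z ≤ A_m * Real.exp (-(R_m * R.carriers.d Z)))
    (hrate : 64 * Real.log 162 + σ + τ * 64 ≤ R_m)
    (hsmall : (1 + s) * A_m * Real.exp (σ * 5 + τ * 64) * B12TreeDecay.K₀ (4 * 2 ^ 4) (2 * 4) * 9 ≤ τ) (hσκ : κ + 1 ≤ σ)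
    -- the term model, the per-term majorant domination, the representation, the levels
    (hwf : 𝔉.WellFormed W)
    (hsum : ∀ g ∈ W, ∀ (U : R.carriers.BgB) (X : R.carriers.Dom), ∀ γ ∈ (B13DomainGeometryTR.clusterRep R ρA ρB).vol X,
      ∑ i ∈ 𝔉.terms g U X γ, 𝔉.G Λop Λhist ρ₀ g U X γ i ≤ m g U γ)
    (hρ01 : ρ₀ ≤ 1)
    (hrep : (B13DomainGeometryTR.clusterRep R ρA ρB).Represents EA EB) (hreal : 𝔉.model.Realizes EA EB W)
    (hbase : 𝔉.model.InBase EB W)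
    (hdA : DecayBound EA W A₀ κ) (hdB : DecayBound EB W E₀ κ)
    -- W1, the insertion-data rates, the age budget, numerics
    (hop : N.OperatorRate W δ θ)
    (hbr : BaseRate LA LB N W δb θ) (hvr : VecRate LA LB N W κ δv θ) (hbudget : LA.AgeBudget N W κ cg ω)
    (hE₀ : 0 ≤ E₀) (hδb : 0 ≤ δb) (hδv : 0 ≤ δv)
    (hE₁ : 0 < E₁) (hΛop : 0 < Λop) (hΛhist : 0 < Λhist) (hρ : max (Λhist / Λop) 1 * ρ₀' ≤ ρ₀)
    (hs : Λhist * ρ₀' < s) (hδ : 0 ≤ δ) (hθ : 0 ≤ θ) (hθ1 : θ < 1)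
    (hcg : 0 ≤ cg) (hω : 0 < ω) (hω1 : ω < 1) (hreachH : cg * (A₀ + E₀) / (1 - ω) < ρ₀')
    {θ' : ℝ} (hθ' : max θ (ω + (τ * 64 * Real.exp (-(σ * 5))) * Λhist / (s - Λhist * ρ₀') * cg) < θ') :
    ∃ C₅, NE5 EA EB W κ θ' C₅ :=
  ne5_above_max_of_domainGeometry_linear (B13DomainGeometryTR.domainGeometry R) ρA ρB 𝔉 hN hLA hLB hdom B13DomainGeometryTR.reach
    (κ₀ := 64 * Real.log 162) (K₀ := B12TreeDecay.K₀ (4 * 2 ^ 4) (2 * 4)) (c₁ := 64) (c := 5) (ν := 9) (E₁ := E₁)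
    B13DomainGeometryTR.loc_b13 B13DomainGeometryTR.reach_b13 hA_m (B12TreeDecay.K₀_pos _ _).le hτ hσ (by norm_num) (by norm_num)
    hs0 hm0 hm B13DomainGeometryTR.ineq126_level B13DomainGeometryTR.volBound_level (fun X => B13DomainGeometryTR.ineq227_level X)
    hrate hsmall hσκ hwf hsum hρ01 hrep hreal hbase hdA hdB hop hbr hvr hbudget hE₀ hδb hδv hE₁ hΛop hΛhist hρ hs hδ hθ hθ1 hcg
    hω hω1 hreachH hθ'

end Summit.QuantumFields.BalabanUV.T4Continuum.B13ActivityRouteEndTR
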